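import Summits.BirchSwinnertonDyer.BirchSwinnertonDyer.Theorems.CyclotomicUntwistGammaOneEigenpacketSpan
import HarnessLib

/-!
# Rigidity of newforms of full level on `Γ₁(L)`: a newform of level `L` shares its eigenpacket off `L`
# with no newform of lower level, and with no other newform of level `L`; multiplicity one for new
# packets (Diamond–Shurman Thm. 5.8.2; route `CyclotomicUntwist`, child C1 — modular-forms layer)

Cell `pub/bsd-wall` (D-0145 line `route-BirchSwinnertonDyer-CyclotomicUntwist`), width seat
`bsd-line-cycu-p4` (gen 12). THEOREMS ONLY (no definition, no named fact, no `sorry`); helper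
`--supports stmt-BirchSwinnertonDyer-27548`, sequel of `CyclotomicUntwistGammaOneEigenpacketSpan` (the
multi-newform `Γ₁` eigenpacket span). BSD is not proved by this file; nothing of the route is closed by it.

The tree has strong multiplicity one ACROSS LEVELS only on `Γ₀`
(`IsNewform0.level_eq_of_heckeEigenvalue_eq_holds`). On `Γ₁` this file proves the part that follows from
the Main Lemma (`atkinLehnerMainLemma1_holds`, Diamond–Shurman Thm. 5.7.1) and `old ∩ new = 0`
(`disjoint_oldSubspace1_newSubspace1_holds`) alone — the TOP-LEVEL case:

* §1 `IsNewform1.level_eq_of_packet_eq` — if `g` is a newform of level `L` and `g'` a newform of level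
  `M' ∣ L` with `a_ℓ(g') = a_ℓ(g)` for all primes `ℓ ∤ L` and `ε_{g'}` inducing `ε_g`, then `M' = L` and
  `aₙ(g') = aₙ(g)` for all `n`: the difference `g − [α_1] g'` is an eigenvector off `L` with `a₁ = 0`, hence
  has vanishing coefficients prime to `L` (`cuspCoeff_eq_zero_of_coprime_gamma1`), hence is OLD (Main
  Lemma); if `M' < L` then `g` itself is old and new, so `0`; if `M' = L` the difference is new and old.
  `IsNewform1.eq_of_packet_eq` — the same-level case: two newforms of level `L` with the same packet off
  `L` are equal (Diamond–Shurman Thm. 5.8.2, uniqueness).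
* §2 `IsNewform1.mem_span_singleton_of_eigenpacket` — **multiplicity one for NEW packets**
  (Diamond–Shurman Thm. 5.8.2(b)): a form `x ∈ S_k(L, ε_g)` with `T_ℓ x = a_ℓ(g) x` for all primes
  `ℓ ∤ L`, `g` a newform of level `L`, is a multiple of `g` — by the eigenpacket span
  (`Gamma1EigenpacketSpan.mem_span_degeneracyMap1_of_eigenpacket`) every generator `[α_d] g''` with the
  packet of `g` has `g'' = g` and `d = 1` (§1).

What is NOT proved here (and not in the tree): strong multiplicity one across levels on `Γ₁` for two
newforms of PROPER levels `M', M'' ∣ L` (Li 1975, Thm. 3; Atkin–Lehner 1970, Thm. 4 on `Γ₀` is the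
tree's `NewformsLevelEqOfHeckeEigenvalueEqProofs`).

References: [cite: DiamondShurman2005, Thm. 5.7.1, Thm. 5.8.2, Thm. 5.8.3] · [cite: Li1975, Thm. 3] ·
[cite: AtkinLehner1970, Thm. 4].
-/

noncomputable section

open scoped MatrixGroups

open CongruenceSubgroup UpperHalfPlane Complex Function
open Literature.NumberTheory.EllipticCurves Literature.NumberTheory.EllipticCurves.ModularForms
open Summit.BirchSwinnertonDyer.BirchSwinnertonDyer.Theorems.Gamma1EigenpacketSpan

-- single-conjunct summit: `Summit.BirchSwinnertonDyer.BirchSwinnertonDyer.…` repeats the name by design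
set_option linter.dupNamespace false
set_option autoImplicit false

namespace Summit.BirchSwinnertonDyer.BirchSwinnertonDyer.Theorems.Gamma1NewformRigidity

/-! ### §1 A newform of full level is rigid among newforms of level dividing `L` -/

section Rigidity

variable {L M' : ℕ} [NeZero L] [NeZero M'] {k : ℤ}

/-- **Top-level strong multiplicity one on `Γ₁(L)`.** Let `g ∈ S_k(Γ₁(L))` be a newform of level `L`
and `g' ∈ S_k(Γ₁(M'))` a newform of level `M' ∣ L` with `a_ℓ(g') = a_ℓ(g)` for every prime `ℓ ∤ L` and
whose nebentypus induces `ε_g` at level `L`. Then `M' = L` and `aₙ(g') = aₙ(g)` for every `n`.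
Proof: `x := g − [α_1] g'` satisfies `T_ℓ x = a_ℓ(g) x` (`ℓ ∤ L`), `⟨u⟩ x = ε_g(u) x` and `a₁(x) = 0`, so
`aₙ(x) = 0` for `(n, L) = 1` (Diamond–Shurman (5.21), `cuspCoeff_eq_zero_of_coprime_gamma1`) and `x` is
old by the Main Lemma (Thm. 5.7.1, `atkinLehnerMainLemma1_holds`); if `M'` were a proper divisor, `[α_1] g'`
and hence `g` would be old, contradicting `old ∩ new = 0` and `a₁(g) = 1`; so `M' = L`, `x = g − g'` is new
and old, `x = 0`. [cite: DiamondShurman2005, Thm. 5.8.2 (proof), Thm. 5.7.1] -/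
theorem IsNewform1.level_eq_of_packet_eq {g : CuspForm (Gamma1 L) k} {g' : CuspForm (Gamma1 M') k}
    (hg : IsNewform1 g) (hg' : IsNewform1 g') (hM' : M' ∣ L)
    (hcoef : ∀ ℓ : ℕ, ℓ.Prime → ¬ ℓ ∣ L → cuspCoeff g' ℓ = cuspCoeff g ℓ)
    (hchar : DirichletCharacter.changeLevel hM' (nebentypus g') = nebentypus g) :
    M' = L ∧ ∀ n : ℕ, cuspCoeff g' n = cuspCoeff g n := by
  have hM'1 : M' * 1 ∣ L := by simpa using hM'
  set x : CuspForm (Gamma1 L) k := g - degeneracyMap1 M' L 1 k g' with hx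
  -- `x` is an eigenvector off `L` with the packet of `g`, and `a₁(x) = 0`
  have hT : ∀ (p : ℕ) (hp : p.Prime), ¬ p ∣ L →
      (haveI : NeZero p := ⟨hp.ne_zero⟩; heckeT (Gamma1 L) k p x) = cuspCoeff g p • x := by
    intro p hp hpL
    haveI : NeZero p := ⟨hp.ne_zero⟩
    rw [hx, map_sub, hg.heckeT_apply_eq_cuspCoeff_smul p hp, heckeT_degeneracyMap1_newform hM'1 hg' hp hpL,
      hcoef p hp hpL, smul_sub]
  have hD : ∀ d : (ZMod L)ˣ, ∃ c : ℂ, diamondOp L k (d : ZMod L) x = c • x := fun d ↦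
    ⟨nebentypus g (d : ZMod L), by
      rw [hx, map_sub, hg.diamondOp_apply_eq_smul d, diamondOp_degeneracyMap1_newform hM'1 hg' d,
        hchar, smul_sub]⟩
  have h1 : cuspCoeff x 1 = 0 := by
    rw [hx, cuspCoeff_sub_gamma1, hg.cuspCoeff_one, cuspCoeff_degeneracyMap1 hM'1, if_pos (dvd_refl 1),
      Nat.div_one, hg'.cuspCoeff_one]
    simp
  have hzero := cuspCoeff_eq_zero_of_coprime_gamma1 x (fun p ↦ cuspCoeff g p) hT hD h1
  have hold : x ∈ oldSubspace1 L k :=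
    mem_oldSubspace1_of_coeff_eq_zero L k (atkinLehnerMainLemma1_holds L k) x
      fun n hn0 hn ↦ hzero n hn0 hn
  -- `M' = L`
  have hML : M' = L := by
    by_contra hne
    have hprop : M' ∈ L.properDivisors :=
      Nat.mem_properDivisors.mpr ⟨hM', lt_of_le_of_ne (Nat.le_of_dvd (NeZero.pos L) hM') hne⟩
    have hold' : degeneracyMap1 M' L 1 k g' ∈ oldSubspace1 L k :=
      range_degeneracyMap1_le_oldSubspace1 L k hprop hM'1 (LinearMap.mem_range_self _ _)
    have hg_old : g ∈ oldSubspace1 L k := by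
      have h := add_mem hold hold'
      rwa [hx, sub_add_cancel] at h
    have hg0 : g = 0 :=
      (Submodule.disjoint_def.mp (disjoint_oldSubspace1_newSubspace1_holds L k)) _ hg_old hg.1
    have h1g := hg.cuspCoeff_one
    rw [hg0, cuspCoeff_zero_form (HeckeTGamma1.one_mem_strictPeriods_Gamma1 L)] at h1g
    exact zero_ne_one h1g
  refine ⟨hML, ?_⟩
  subst hML
  -- same level: `x = g − g'` is new and old
  have hx' : x = g - g' := by rw [hx, degeneracyMap1_self_one]
  have hnew : x ∈ newSubspace1 _ k := by rw [hx']; exact sub_mem hg.1 hg'.1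
  have hx0 : x = 0 :=
    (Submodule.disjoint_def.mp (disjoint_oldSubspace1_newSubspace1_holds _ k)) _ hold hnew
  have hgg : g = g' := sub_eq_zero.mp (hx' ▸ hx0)
  intro n
  rw [hgg]

/-- **Uniqueness of the newform with a given packet at level `L`** (Diamond–Shurman Thm. 5.8.2): two
newforms of level `L` with the same `T_ℓ`-eigenvalues for all primes `ℓ ∤ L` and the same nebentypus are
equal. [cite: DiamondShurman2005, Thm. 5.8.2] -/
theorem IsNewform1.eq_of_packet_eq {g g' : CuspForm (Gamma1 L) k} (hg : IsNewform1 g) (hg' : IsNewform1 g')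
    (hcoef : ∀ ℓ : ℕ, ℓ.Prime → ¬ ℓ ∣ L → cuspCoeff g' ℓ = cuspCoeff g ℓ)
    (hchar : nebentypus g' = nebentypus g) : g' = g := by
  refine eq_of_forall_cuspCoeff_eq_gamma1 (IsNewform1.level_eq_of_packet_eq hg hg' dvd_rfl hcoef ?_).2
  rw [DirichletCharacter.changeLevel_self, hchar]

end Rigidity

/-! ### §2 Multiplicity one for new packets -/

section MultiplicityOne

variable {L : ℕ} [NeZero L] {k : ℤ}

/-- **Multiplicity one for the packet of a newform of full level** (Diamond–Shurman Thm. 5.8.2(b)): if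
`g` is a newform of level `L` and `x ∈ S_k(L, ε_g)` satisfies `T_ℓ x = a_ℓ(g) x` for every prime `ℓ ∤ L`,
then `x ∈ ℂ·g`. Proof: by the eigenpacket span `x` is a combination of the `[α_d] g''` over the newforms
`g''` (levels `M₀`, `M₀ d ∣ L`) carrying the packet of `g`; by §1 each such `g''` has `M₀ = L`, so `d = 1`
and `[α_1] g'' = g'' = g`. [cite: DiamondShurman2005, Thm. 5.8.2(b), Thm. 5.8.3] -/
theorem IsNewform1.mem_span_singleton_of_eigenpacket {g : CuspForm (Gamma1 L) k} (hg : IsNewform1 g)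
    {x : CuspForm (Gamma1 L) k} (hxχ : x ∈ nebentypusSubspace L k (nebentypus g))
    (hT : ∀ (p : ℕ) (hp : p.Prime), ¬ p ∣ L →
      (haveI : NeZero p := ⟨hp.ne_zero⟩; heckeT (Gamma1 L) k p x) = cuspCoeff g p • x) :
    x ∈ Submodule.span ℂ {g} := by
  have hmem := mem_span_degeneracyMap1_of_eigenpacket (a := fun p ↦ cuspCoeff g p) hxχ hT
  refine Submodule.span_mono ?_ hmem
  rintro b ⟨M₀, _, d, _, hMd, g'', hg'', hcoef, hchar, rfl⟩
  obtain ⟨hM₀L, hall⟩ :=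
    IsNewform1.level_eq_of_packet_eq hg hg'' ((dvd_mul_right M₀ d).trans hMd) hcoef hchar
  subst hM₀L
  have hd : d = 1 := by
    have hle : M₀ * d ≤ M₀ * 1 := by rw [mul_one]; exact Nat.le_of_dvd (NeZero.pos M₀) hMd
    have hd1 : d ≤ 1 := Nat.le_of_mul_le_mul_left hle (NeZero.pos M₀)
    have hd0 : d ≠ 0 := NeZero.ne d
    omega
  subst hd
  rw [Set.mem_singleton_iff, degeneracyMap1_self_one]
  exact eq_of_forall_cuspCoeff_eq_gamma1 hall

end MultiplicityOne

end Summit.BirchSwinnertonDyer.BirchSwinnertonDyer.Theorems.Gamma1NewformRigidity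

end
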